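import Summits.HodgeConjecture.HodgeConjecture.Theorems.Ring2HypothesesMTAnchorsOfFlatSections
import Literature.AlgebraicGeometry.Motives.CurveThroughTwoPointsSeparated
import Literature.AlgebraicGeometry.HodgeTheory.RelativeHyperplaneClassHodgeRiemann
import HarnessLib

/-!
# Ring 2 — hypotheses layer: row b01 (`MumfordTateCMAnchors`) over SEPARATED bases is its curve form; one CM point suffices

HONEST FRAMING: research route conditional on HC_CM; not a corollary; Q11.4-sentence-2 already refuted in dim ≥ 3.

Cell `pub-hodge-ring2`, binder-prover seat `ring2-b01` (gen 8), BINDER-OWNERS row b01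
(`Ring2.Hypotheses.MumfordTateCMAnchors`: KIND CITE, kernel-bound `↔` the named fact
`Abdulali1994.deligne1982_exists_cmAnchoredHodgeFamily`). Sequel to gen 7's
`Ring2HypothesesMTAnchorsOfFlatSections` (engine `curveAnchorsFor_of_flatSection`: anchor and CM point in a
COMMON AFFINE OPEN of the base ⟹ the curve form `MTAnchorsCurve[]`; `MTFlatDense[] ⟹ MTAnchorsCurve[] ⟹
MumfordTateCMAnchors`). `HC_CM` (`Theses.RankFourFaces.CMAbelianHodge`) does not occur in this file; nothing
here proves a case of the Hodge conjecture; no definition, no named fact, no `sorry`.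

## What this part adds

Gen 7 left two gaps between the binder AS TYPED and its curve form: (1) in `MumfordTateCMAnchors` the anchor
`s₁` and the CM point `s₀` need not lie in a common affine open of the (arbitrary smooth irreducible) base;
(2) the flat-section input `MTFlatDense[]` asks for a DENSE CM locus although the engine consumes ONE CM point
near the anchor (referee ref1, advisory A-85.1). Both are closed here for SEPARATED bases — every base in
print is quasi-projective, hence separated — by Mumford's two-point lemma for separated irreducible varieties,
now a tree THEOREM (`Motives.mumford_smoothCurve_through_two_points_of_isSeparated_of_smooth`,
`Literature/…/Motives/CurveThroughTwoPointsSeparated`, this seat: Chow's lemma `Resolution.ChowLemmaIntegral_holds`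
+ finite subsets of a quasi-projective scheme lie in an affine open + the affine case):

* `curveAnchorsFor_of_flatSection_of_isSeparated` (ENGINE v2) — a smooth projective abelian-fibred family over
  a smooth irreducible SEPARATED base, a flat Hodge section through `(A, c)` at `s₁`, and a CM point `s₀`
  ANYWHERE on the base ⟹ `CurveAnchorsFor[A, p, c]` (join `s₁` to `s₀` by a smooth affine curve mapping to the
  base, base-change, topological partie fixe over the curve — gen 6/7); `curveAnchorsFor_of_globalClass_of_isSeparated`.
* `MTFlatSep[]` (file-local notation) — Charles–Schnell Thm. 11.5.11 (a) + (b) in FLAT-SECTION form + ONE CM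
  point, over a smooth irreducible separated base: no density, no global class, no quasi-projectivity of `𝒳`;
  `mtAnchorsCurve_of_flatSep : MTFlatSep[] → MTAnchorsCurve[]` (answers A-85.1: the consumed input is one CM
  fibre, not a dense CM locus), `mtAnchorsCurve_iff_flatSep : MTAnchorsCurve[] ↔ MTFlatSep[]`;
  `mtFlatSep_of_deligne1982` (the refereed fact c8 delivers it).
* `MTAnchorsSep[]` (file-local notation) — the body of `MumfordTateCMAnchors` with the base additionally
  SEPARATED over `ℂ`; **`mtAnchorsCurve_iff_sep : MTAnchorsCurve[] ↔ MTAnchorsSep[]`** and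
  `mumfordTateCMAnchors_of_sep : MTAnchorsSep[] → MumfordTateCMAnchors`: over separated bases the binder IS its
  curve form. The only residual between the binder as typed and its curve form is a typing artefact — smooth
  irreducible bases NOT separated over `ℂ` (the typed `∃ (𝒳 S : SchemeOver ℂ) …` does not exclude them; no
  printed family lives over such a base).

KIND of row b01 unchanged (CITE); «10 · 0» unchanged; no new binder, no new node outside this file's local
notations.

Sources. [CharlesSchnell2014Notes] Thm. 11.5.11 and proof pp. 516–518; [Deligne1982HodgeCycles] Prop. 6.1;
[MumfordAV1970] §6 Lemma ("By Chow's lemma we may assume `X` projective"); [GortzWedhorn2020] Thm. 13.100;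
[VoisinHodgeII2003] Thm. 4.18, §3.1.1; [Hartshorne1977] II Thm. 4.9.
-/

-- every declaration of this problem lives in `Summit.HodgeConjecture.HodgeConjecture.…` (summit = sub-problem)
set_option linter.dupNamespace false

noncomputable section

open CategoryTheory AlgebraicGeometry Topology Filter
open Literature.AlgebraicGeometry Literature.AlgebraicGeometry.Motives Literature.AlgebraicGeometry.HodgeTheory
open Literature.AlgebraicGeometry.Deligne1982 (cmLocus deligne1982_cmDenseMumfordTateFamilies)

namespace Summit.HodgeConjecture.HodgeConjecture.Ring2.Hypotheses

/-! ## §0 File-local notations (no definition is introduced)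

`CurveAnchorsFor[A, p, c]` and `MTAnchorsCurve[]` are repeated byte for byte from
`Ring2HypothesesMTAnchorsOfFlatSections` (local notations do not cross files). -/

/-- `CurveAnchorsFor[A, p, c]` — the body of `MumfordTateCMAnchors` for the class `c ∈ H^{2p}(A(ℂ); ℂ)`, with the
base additionally AFFINE of topological Krull dimension `≤ 1` (verbatim the notation of
`Ring2HypothesesMTAnchorsOfFlatSections`). Local notation only. -/
local notation3 (prettyPrint := false) "CurveAnchorsFor[" A ", " p ", " c "]" =>
  ∃ (𝒳 S : SchemeOver ℂ) (f : 𝒳 ⟶ S) (s₁ s₀ : ComplexPoints S) (e : AbelianVariety.X A ≅ fiberOver f s₁)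
    (W : complexBetti 𝒳 (2 * p)) (A₀ : AbelianVariety ℂ),
    IsSmoothProjectiveFamily f (AbelianVariety.dim A) ∧ IrreducibleSpace S.left ∧
    AlgebraicGeometry.Smooth S.hom ∧ IsAffine S.left ∧ topologicalKrullDim S.left ≤ 1 ∧
    (∀ s : ComplexPoints S, ∃ A' : AbelianVariety ℂ,
      A'.dim = AbelianVariety.dim A ∧ Nonempty (A'.X ≅ fiberOver f s)) ∧
    (∀ s : ComplexPoints S, IsRationalClass (complexBetti.map (fiberι f s) (2 * p) W) ∧
      IsOfHodgeType (AbelianVariety.dim A) (fiberOver f s) (2 * p) p p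
        (complexBetti.map (fiberι f s) (2 * p) W)) ∧
    complexBetti.map e.hom (2 * p) (complexBetti.map (fiberι f s₁) (2 * p) W) = c ∧
    A₀.dim = AbelianVariety.dim A ∧ Nonempty (A₀.X ≅ fiberOver f s₀) ∧
    (∃ E : Subalgebra ℚ A₀.endAlgebra, IsReduced ↥E ∧ (∀ x ∈ E, ∀ y ∈ E, x * y = y * x) ∧
      Module.finrank ℚ ↥E = 2 * A₀.dim)

/-- `MTAnchorsCurve[]` — `MumfordTateCMAnchors` OVER CURVE BASES (verbatim the notation of
`Ring2HypothesesMTAnchorsOfFlatSections`). Local notation only. -/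
local notation3 (prettyPrint := false) "MTAnchorsCurve[]" =>
  ∀ (A : AbelianVariety ℂ), IsSmoothProjective A.dim A.X →
    ∀ (p : ℕ) (c : complexBetti A.X (2 * p)), IsRationalClass c →
      IsOfHodgeType A.dim A.X (2 * p) p p c → CurveAnchorsFor[A, p, c]

/-- `MTAnchorsSep[]` — the body of `MumfordTateCMAnchors` (`Ring2Hypotheses.lean` §1b) with ONE clause added:
the base `S` is SEPARATED over `ℂ` (`IsSeparated S.hom`). Local notation only. -/
local notation3 (prettyPrint := false) "MTAnchorsSep[]" =>
  ∀ (A : AbelianVariety ℂ), IsSmoothProjective A.dim A.X →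
    ∀ (p : ℕ) (c : complexBetti A.X (2 * p)), IsRationalClass c →
      IsOfHodgeType A.dim A.X (2 * p) p p c →
        ∃ (𝒳 S : SchemeOver ℂ) (f : 𝒳 ⟶ S) (s₁ s₀ : ComplexPoints S) (e : A.X ≅ fiberOver f s₁)
          (W : complexBetti 𝒳 (2 * p)) (A₀ : AbelianVariety ℂ),
          IsSmoothProjectiveFamily f A.dim ∧ IrreducibleSpace S.left ∧ AlgebraicGeometry.Smooth S.hom ∧
          IsSeparated S.hom ∧
          (∀ s : ComplexPoints S, ∃ A' : AbelianVariety ℂ, A'.dim = A.dim ∧ Nonempty (A'.X ≅ fiberOver f s)) ∧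
          (∀ s : ComplexPoints S, IsRationalClass (complexBetti.map (fiberι f s) (2 * p) W) ∧
            IsOfHodgeType A.dim (fiberOver f s) (2 * p) p p (complexBetti.map (fiberι f s) (2 * p) W)) ∧
          complexBetti.map e.hom (2 * p) (complexBetti.map (fiberι f s₁) (2 * p) W) = c ∧
          A₀.dim = A.dim ∧ Nonempty (A₀.X ≅ fiberOver f s₀) ∧
          (∃ E : Subalgebra ℚ A₀.endAlgebra, IsReduced ↥E ∧ (∀ x ∈ E, ∀ y ∈ E, x * y = y * x) ∧
            Module.finrank ℚ ↥E = 2 * A₀.dim)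

/-- `MTFlatSep[]` — Charles–Schnell Thm. 11.5.11 (a) with (b) in FLAT-SECTION form and ONE CM point, over a
smooth irreducible SEPARATED base: a smooth projective abelian-fibred family of relative dimension `dim A`, a
CONTINUOUS SECTION `σ` of the espace étalé of `R^{2p}f_*ℂ` valued in the locus of Hodge classes through
`(s₁, (e⁻¹)^* c)` for a chart `e : A ≅ 𝒳_{s₁}`, and a point `s₀` of the CM locus. No density, no global class,
no quasi-projectivity. Local notation only. -/
local notation3 (prettyPrint := false) "MTFlatSep[]" =>
  ∀ (A : AbelianVariety ℂ), IsSmoothProjective A.dim A.X →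
    ∀ (p : ℕ) (c : complexBetti A.X (2 * p)), IsRationalClass c →
      IsOfHodgeType A.dim A.X (2 * p) p p c →
        ∃ (𝒳 S : SchemeOver ℂ) (f : 𝒳 ⟶ S) (σ : ComplexPoints S → FiberClass f (2 * p))
          (s₁ : ComplexPoints S) (e : A.X ≅ fiberOver f s₁) (s₀ : ComplexPoints S),
          IsSmoothProjectiveFamily f A.dim ∧ IrreducibleSpace S.left ∧ AlgebraicGeometry.Smooth S.hom ∧
          IsSeparated S.hom ∧
          (∀ s : ComplexPoints S, ∃ A' : AbelianVariety ℂ, A'.dim = A.dim ∧ Nonempty (A'.X ≅ fiberOver f s)) ∧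
          Continuous σ ∧ (∀ s, (σ s).pt = s) ∧ (∀ s, σ s ∈ locusOfHodgeClasses f A.dim p) ∧
          σ s₁ = ⟨s₁, complexBetti.map e.inv (2 * p) c⟩ ∧
          s₀ ∈ cmLocus f A.dim

/-! ## §1 The engine over separated bases -/

section Engine

variable {A : AbelianVariety ℂ} {p : ℕ} {c : complexBetti A.X (2 * p)}

/-- **ENGINE v2 — curve anchors from a flat section over a SEPARATED base.** Let `f : 𝒳 ⟶ S` be a smooth
projective abelian-fibred family of relative dimension `dim A` over a smooth irreducible `S` separated over `ℂ`
(total space and base otherwise arbitrary), `σ` a continuous section of the espace étalé of `R^{2p}f_*ℂ` valued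
in the locus of Hodge classes with `e^*(σ(s₁)) = c`, and `s₀` ANY point of the CM locus. Then
`CurveAnchorsFor[A, p, c]`. Proof: if `s₀ = s₁`, gen 7's engine in an affine open around `s₁`; otherwise
Mumford's two-point lemma for separated irreducible varieties (tree theorem
`Motives.mumford_smoothCurve_through_two_points_of_isSeparated_of_smooth`: Chow's lemma + the affine case) gives
a smooth irreducible affine curve `g : C ⟶ S` through `s₁` and `s₀`, and `curveAnchorsFor_of_curve` (base change;
the flat section over the curve is the global section of one class) concludes. NO named fact.
[cite: CharlesSchnell2014Notes, proof of Thm. 11.5.11 (pp. 517–518)] [cite: MumfordAV1970, §6 Lemma]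
[cite: GortzWedhorn2020, Thm. 13.100] [cite: VoisinHodgeII2003, Thm. 4.18] -/
theorem curveAnchorsFor_of_flatSection_of_isSeparated {𝒳 S : SchemeOver ℂ} (f : 𝒳 ⟶ S)
    (hf : IsSmoothProjectiveFamily f A.dim) [IrreducibleSpace S.left] [AlgebraicGeometry.Smooth S.hom]
    [IsSeparated S.hom]
    (hab : ∀ s : ComplexPoints S, ∃ A' : AbelianVariety ℂ, A'.dim = A.dim ∧ Nonempty (A'.X ≅ fiberOver f s))
    {σ : ComplexPoints S → FiberClass f (2 * p)} (hσ : Continuous σ) (hpt : ∀ s, (σ s).pt = s)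
    (hH : ∀ s, σ s ∈ locusOfHodgeClasses f A.dim p) {s₁ s₀ : ComplexPoints S}
    (he : ∃ e : A.X ≅ fiberOver f (σ s₁).pt, complexBetti.map e.hom (2 * p) (σ s₁).cls = c)
    (hs₀ : s₀ ∈ cmLocus f A.dim) : CurveAnchorsFor[A, p, c] := by
  by_cases h : s₀ = s₁
  · -- one point: gen 7's engine in an affine open around `s₁`
    obtain ⟨U, hU, h₁U, -⟩ := exists_isAffineOpen_mem_and_subset (U := ⊤) (x := s₁.pt) trivial
    exact curveAnchorsFor_of_flatSection f hf hab hσ hpt hH he hs₀ U hU h₁U (h ▸ h₁U)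
  · -- two points: a smooth affine curve through both (Mumford, separated form)
    obtain ⟨C, g, a', b', hCaff, hCirr, hCsm, hCdim, ha', hb'⟩ :=
      mumford_smoothCurve_through_two_points_of_isSeparated_of_smooth s₁ s₀ (Ne.symm h)
    exact curveAnchorsFor_of_curve f hf hab hσ hpt hH he hs₀ g hCaff hCirr hCsm hCdim ha' hb'

/-- **Global-class form of engine v2**: a b01-type family (global class `W`) over a smooth irreducible base
SEPARATED over `ℂ`, with anchor `s₁` and CM point `s₀` anywhere, can be replaced by one over a smooth
irreducible affine curve (or a point). [cite: MumfordAV1970, §6 Lemma] [cite: GortzWedhorn2020, Thm. 13.100] -/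
theorem curveAnchorsFor_of_globalClass_of_isSeparated {𝒳 S : SchemeOver ℂ} (f : 𝒳 ⟶ S)
    (hf : IsSmoothProjectiveFamily f A.dim) [IrreducibleSpace S.left] [AlgebraicGeometry.Smooth S.hom]
    [IsSeparated S.hom]
    (hab : ∀ s : ComplexPoints S, ∃ A' : AbelianVariety ℂ, A'.dim = A.dim ∧ Nonempty (A'.X ≅ fiberOver f s))
    (W : complexBetti 𝒳 (2 * p))
    (hW : ∀ s : ComplexPoints S, IsRationalClass (complexBetti.map (fiberι f s) (2 * p) W) ∧
      IsOfHodgeType A.dim (fiberOver f s) (2 * p) p p (complexBetti.map (fiberι f s) (2 * p) W))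
    {s₁ s₀ : ComplexPoints S} (e : A.X ≅ fiberOver f s₁)
    (he : complexBetti.map e.hom (2 * p) (complexBetti.map (fiberι f s₁) (2 * p) W) = c)
    (hs₀ : s₀ ∈ cmLocus f A.dim) : CurveAnchorsFor[A, p, c] :=
  curveAnchorsFor_of_flatSection_of_isSeparated f hf hab (continuous_globalSection f (2 * p) W) (fun _ => rfl)
    (fun s => globalSection_mem_locusOfHodgeClasses (hW s).1 (hW s).2) (s₁ := s₁) ⟨e, he⟩ hs₀

end Engine

/-! ## §2 One CM point suffices: `MTFlatSep[] ⟹ MTAnchorsCurve[]` -/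

/-- **`MTFlatSep[] ⟹ MTAnchorsCurve[]`** — Thm. 11.5.11 (a) + flat (b) + ONE CM point over a separated base gives
the curve form of row b01 (engine v2). The input consumed is one CM fibre, not a dense CM locus (referee advisory
A-85.1 on `MTFlatDense[]`). [cite: CharlesSchnell2014Notes, Thm. 11.5.11 (a)(b) and proof] -/
theorem mtAnchorsCurve_of_flatSep (h : MTFlatSep[]) : MTAnchorsCurve[] := by
  intro A hA p c hc hpp
  obtain ⟨𝒳, S, f, σ, s₁, e, s₀, hf, hirr, hsm, hsep, hab, hσ, hpt, hH, he, hs₀⟩ := h A hA p c hc hpp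
  haveI := hirr
  haveI := hsm
  haveI := hsep
  exact curveAnchorsFor_of_flatSection_of_isSeparated f hf hab hσ hpt hH (exists_anchor_of_eq_mk f e c he) hs₀

/-- **The refereed dense fact gives `MTFlatSep[]`** (c8, `Deligne1982.deligne1982_cmDenseMumfordTateFamilies`:
the global section of the global class is a flat Hodge section; a quasi-projective base is separated,
`HodgeTheory.IsQuasiProjectiveOver.isSeparated`; a dense CM locus in the non-empty `S(ℂ)` has a point).
[cite: CharlesSchnell2014Notes, Thm. 11.5.11] [cite: Deligne1982HodgeCycles, Prop. 6.1 and proof (pp. 71–73)] -/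
theorem mtFlatSep_of_deligne1982 (h : deligne1982_cmDenseMumfordTateFamilies) : MTFlatSep[] := by
  intro A hA p c hc hpp
  obtain ⟨𝒳, S, f, s₁, e, W, hf, -, hS, hirr, hsm, hab, hW, hWc, hD⟩ := h A hA p c hc hpp
  obtain ⟨s₀, hs₀, -⟩ := hD.exists_mem_open isOpen_univ ⟨s₁, Set.mem_univ _⟩
  refine ⟨𝒳, S, f, globalSection f (2 * p) W, s₁, e, s₀, hf, hirr, hsm, hS.isSeparated, hab,
    continuous_globalSection f (2 * p) W, fun _ => rfl,
    fun s => globalSection_mem_locusOfHodgeClasses (hW s).1 (hW s).2, ?_, hs₀⟩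
  change (⟨s₁, complexBetti.map (fiberι f s₁) (2 * p) W⟩ : FiberClass f (2 * p)) = _
  rw [← hWc, e.complexBetti_map_inv_map_hom]

/-! ## §3 Over separated bases the binder IS its curve form -/

/-- **`MTAnchorsSep[] ⟹ MTAnchorsCurve[]`** — a b01 family over a smooth irreducible base SEPARATED over `ℂ` can
be replaced by one over a smooth irreducible affine curve (or a point): the global section of `W` is a flat Hodge
section, the CM fibre `A₀ ≅ 𝒳_{s₀}` puts `s₀` in the CM locus, engine v2.
[cite: CharlesSchnell2014Notes, Thm. 11.5.11] [cite: MumfordAV1970, §6 Lemma] -/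
theorem mtAnchorsCurve_of_sep (h : MTAnchorsSep[]) : MTAnchorsCurve[] := by
  intro A hA p c hc hpp
  obtain ⟨𝒳, S, f, s₁, s₀, e, W, A₀, hf, hirr, hsm, hsep, hab, hW, hWc, hdim₀, he₀, hcm₀⟩ := h A hA p c hc hpp
  haveI := hirr
  haveI := hsm
  haveI := hsep
  exact curveAnchorsFor_of_globalClass_of_isSeparated f hf hab W hW e hWc ⟨A₀, he₀, hdim₀, hcm₀⟩

/-- **`MTAnchorsCurve[] ⟹ MTAnchorsSep[]`** (an affine base is separated over `ℂ`: `IsSeparated.of_isAffineHom`).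
[folklore] -/
theorem mtAnchorsSep_of_curve (h : MTAnchorsCurve[]) : MTAnchorsSep[] := by
  intro A hA p c hc hpp
  obtain ⟨𝒳, S, f, s₁, s₀, e, W, A₀, hf, hirr, hsm, haff, -, hab, hW, hWc, hdim₀, he₀, hcm₀⟩ := h A hA p c hc hpp
  haveI := haff
  exact ⟨𝒳, S, f, s₁, s₀, e, W, A₀, hf, hirr, hsm, IsSeparated.of_isAffineHom _, hab, hW, hWc, hdim₀, he₀, hcm₀⟩

/-- **Over separated bases the binder of row b01 IS its curve form: `MTAnchorsCurve[] ↔ MTAnchorsSep[]`.** The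
residual between `MumfordTateCMAnchors` as typed and `MTAnchorsCurve[]` is exactly the typing artefact "smooth
irreducible base not separated over `ℂ`" (no printed Mumford–Tate family has such a base: Deligne's and
Charles–Schnell's bases are quasi-projective). [cite: CharlesSchnell2014Notes, Thm. 11.5.11]
[cite: MumfordAV1970, §6 Lemma] [cite: GortzWedhorn2020, Thm. 13.100] -/
theorem mtAnchorsCurve_iff_sep : MTAnchorsCurve[] ↔ MTAnchorsSep[] :=
  ⟨mtAnchorsSep_of_curve, mtAnchorsCurve_of_sep⟩

/-- **`MTAnchorsSep[] ⟹ MumfordTateCMAnchors`** (forget separatedness). [folklore] -/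
theorem mumfordTateCMAnchors_of_sep (h : MTAnchorsSep[]) : MumfordTateCMAnchors := by
  intro A hA p c hc hpp
  obtain ⟨𝒳, S, f, s₁, s₀, e, W, A₀, hf, hirr, hsm, -, hab, hW, hWc, hdim₀, he₀, hcm₀⟩ := h A hA p c hc hpp
  exact ⟨𝒳, S, f, s₁, s₀, e, W, A₀, hf, hirr, hsm, hab, hW, hWc, hdim₀, he₀, hcm₀⟩

/-- **`MTAnchorsSep[] ⟹ MTFlatSep[]`** — the global section `s ↦ (s, W|_{𝒳_s})` of the global class is a flat
Hodge section through `(s₁, (e⁻¹)^* c)` (`continuous_globalSection`, `e.complexBetti_map_inv_map_hom`), and the CM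
fibre `A₀ ≅ 𝒳_{s₀}` puts `s₀` in the CM locus. [cite: CharlesSchnell2014Notes, Conj. 11.3.1 and Thm. 11.5.11 (b)] -/
theorem mtFlatSep_of_sep (h : MTAnchorsSep[]) : MTFlatSep[] := by
  intro A hA p c hc hpp
  obtain ⟨𝒳, S, f, s₁, s₀, e, W, A₀, hf, hirr, hsm, hsep, hab, hW, hWc, hdim₀, he₀, hcm₀⟩ := h A hA p c hc hpp
  refine ⟨𝒳, S, f, globalSection f (2 * p) W, s₁, e, s₀, hf, hirr, hsm, hsep, hab,
    continuous_globalSection f (2 * p) W, fun _ => rfl,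
    fun s => globalSection_mem_locusOfHodgeClasses (hW s).1 (hW s).2, ?_, ⟨A₀, he₀, hdim₀, hcm₀⟩⟩
  change (⟨s₁, complexBetti.map (fiberι f s₁) (2 * p) W⟩ : FiberClass f (2 * p)) = _
  rw [← hWc, e.complexBetti_map_inv_map_hom]

/-- **The three separated-base forms of row b01 are equivalent: `MTAnchorsCurve[] ↔ MTFlatSep[]`** (with
`mtAnchorsCurve_iff_sep`): curve base with a global class ⟺ separated base with a global class and one CM fibre ⟺
separated base with a FLAT Hodge section and one CM point. [cite: CharlesSchnell2014Notes, Thm. 11.5.11]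
[cite: MumfordAV1970, §6 Lemma] -/
theorem mtAnchorsCurve_iff_flatSep : MTAnchorsCurve[] ↔ MTFlatSep[] :=
  ⟨fun h => mtFlatSep_of_sep (mtAnchorsSep_of_curve h), mtAnchorsCurve_of_flatSep⟩

/-- **Row b01 from `MTFlatSep[]`**: Thm. 11.5.11 (a) + flat (b) + one CM point over a separated base already gives
`MumfordTateCMAnchors` — neither the global invariant cycle theorem, nor quasi-projectivity, nor the density of
CM points is an input of row b01 in the kernel. KIND of the row unchanged (CITE).
[cite: CharlesSchnell2014Notes, Thm. 11.5.11 and proof (pp. 516–518)] [cite: Deligne1982HodgeCycles, Prop. 6.1] -/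
theorem mumfordTateCMAnchors_of_flatSep (h : MTFlatSep[]) : MumfordTateCMAnchors :=
  mumfordTateCMAnchors_of_curve (mtAnchorsCurve_of_flatSep h)

/-! ## Audit

No definition, no named fact, no `sorry`; `HC_CM` does not occur. The four notations are file-local. Every
theorem concluding `MumfordTateCMAnchors` / `MTAnchorsCurve[]` carries a displayed hypothesis (`MTFlatSep[]`,
`MTAnchorsSep[]`, or the Literature fact `deligne1982_cmDenseMumfordTateFamilies`) — a REDUCTION of the row's
printed input, crediting nothing; the engine is hypothesis-free mathematics (Chow's lemma, Mumford's lemma and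
the curve-base partie fixe are tree THEOREMS). Axiom closures: the three standard axioms only. -/

#print axioms Summit.HodgeConjecture.HodgeConjecture.Ring2.Hypotheses.curveAnchorsFor_of_flatSection_of_isSeparated
#print axioms Summit.HodgeConjecture.HodgeConjecture.Ring2.Hypotheses.mtAnchorsCurve_iff_sep
#print axioms Summit.HodgeConjecture.HodgeConjecture.Ring2.Hypotheses.mtAnchorsCurve_iff_flatSep
#print axioms Summit.HodgeConjecture.HodgeConjecture.Ring2.Hypotheses.mtFlatSep_of_deligne1982

end Summit.HodgeConjecture.HodgeConjecture.Ring2.Hypotheses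

end
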